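import Literature.NumberTheory.Sieve.MoebiusExpSumDavenport
import HarnessLib

/-!
# Möbius and quadratic phases, I: the major arcs (Green–Tao 2008, Proposition 18)

Topic `Literature/NumberTheory/Sieve` (circle method). Everything in this file is PROVED
(theorems only; no definitions, no named facts). Second file of the tree's proof of the
classical estimate (Hua; Green–Tao, *Quadratic uniformity of the Möbius function*, Ann. Inst.
Fourier 58 (2008) = arXiv:math/0606087, §1 eq. (mu-quad) / §7 eq. (mu-alphabeta))

  `∑_{n ≤ N} μ(n) e(αn² + βn) ≪_A N (log N)^{-A}`   uniformly in `α, β`.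

Here: the **major arcs**. Green–Tao's Proposition 18 ("Major arc quadratic phases are orthogonal
to Möbius"): if `‖α‖_{ℝ/ℤ,Q} ≤ K/N²` then
`𝔼_{N<n≤2N} μ(n) e(−αn² − βn − γ) ≪_{A'} Q^{1/3}K^{1/3} log^{−A'} N`. We prove the form in which it is
used (there `Q = K = C_A log^{C(A+1)} N`), for the initial sum `∑_{n ≤ N}`:

* `HuaQuadratic.majorArc` — for all `A, B > 0` there is `C` with
  `‖∑_{n ≤ N} μ(n) e(αn² + βn)‖ ≤ C N/(log N)^A` whenever `N ≥ 2`, `1 ≤ q ≤ (log N)^B`, `a ∈ ℤ`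
  and `|α − a/q| ≤ (log N)^B/(q N²)`.

## Proof (Green–Tao §7, proof of Prop. 18, with Abel summation in place of short intervals)

Write `θ = α − a/q`. The phase `e(an²/q)` depends only on `n mod q`; on the residue class
`n ≡ r (q)` the sum is `∑ μ(n) e(βn) · e(θn²)` and the factor `e(θn²)` varies slowly
(`‖e(θ(m+1)²) − e(θm²)‖ ≤ 2π|θ|(2m+1) ≤ 4π(log N)^B/(qN)`), so Abel summation
(`MoebiusDavenport.norm_sum_mul_le_of_lipschitz`, Green–Tao App. A Lemma 33) reduces everything to
the LINEAR Möbius sums on progressions `∑_{n ≤ m, n ≡ r (q)} μ(n) e(βn)`, bounded uniformly in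
`q, r, β` by Davenport's theorem in progressions (`MoebiusDavenport.davenport_progression`, with
saving `(log)^{−A−B}`; trivial bound below `√N`). Summing the `q ≤ (log N)^B` classes loses
`(log N)^B`.

## References
* B. Green, T. Tao, Ann. Inst. Fourier 58 (2008) 1863–1935 = arXiv:math/0606087, §7 Proposition 18.
  [GreenTao2008QuadraticMobius]
* (Classical source of the estimate: L.-K. Hua, *Additive theory of prime numbers*, AMS Transl.
  Math. Monogr. 13 (1965); Green–Tao call it the model case of their Main Theorem.)
-/

noncomputable section

open Finset Real Filter Asymptotics ArithmeticFunction
open scoped FourierTransform ArithmeticFunction.Moebius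

namespace Literature.NumberTheory.Sieve.HuaQuadratic

open Literature.NumberTheory.Sieve.Vinogradov (norm_fourierChar norm_fourierChar_sub_one)
open Literature.NumberTheory.Sieve.MoebiusDavenport (davenport_progression norm_sum_mul_le_of_lipschitz)
open Literature.NumberTheory.Sieve.FejerCounting (fourierChar_add_intCast)

/-! ### Tools -/

/-- Powers of `log N` are eventually below any power of `N` (along the naturals). [folklore] -/
private theorem eventually_log_rpow_le_rpow (K : ℝ) {ε : ℝ} (hε : 0 < ε) :
    ∀ᶠ N : ℕ in atTop, Real.log N ^ K ≤ (N : ℝ) ^ ε := by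
  have h := ((isLittleO_log_rpow_rpow_atTop K hε).comp_tendsto
    tendsto_natCast_atTop_atTop).bound zero_lt_one
  filter_upwards [h] with N hN
  have h1 : 0 ≤ Real.log N ^ K := Real.rpow_nonneg (Real.log_natCast_nonneg N) K
  have h2 : 0 ≤ (N : ℝ) ^ ε := Real.rpow_nonneg (Nat.cast_nonneg N) ε
  simpa [Function.comp, Real.norm_of_nonneg h1, Real.norm_of_nonneg h2] using hN

/-- `log N` is eventually `≥ c` (along the naturals). [folklore] -/
private theorem eventually_le_log (c : ℝ) : ∀ᶠ N : ℕ in atTop, c ≤ Real.log N :=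
  (Real.tendsto_log_atTop.comp tendsto_natCast_atTop_atTop).eventually_ge_atTop c

/-- On `n ≡ r (q)` the phase `e(an²/q)` is `e(ar²/q)`: for `α = a/q + θ`,
`e(αn² + βn) = e((n mod q)² a/q) · (e(nβ) e(θn²))`. [folklore] -/
private theorem fourierChar_quad_rat_add (n : ℕ) {q : ℕ} (hq : 1 ≤ q) (a : ℤ) (θ β : ℝ) :
    (𝐞 (((a : ℝ) / q + θ) * (n : ℝ) ^ 2 + β * n) : ℂ) =
      (𝐞 ((((n % q : ℕ) : ℝ) ^ 2) * ((a : ℝ) / q)) : ℂ) *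
        ((𝐞 ((n : ℝ) * β) : ℂ) * (𝐞 (θ * (n : ℝ) ^ 2) : ℂ)) := by
  have hq0 : (q : ℝ) ≠ 0 := by exact_mod_cast (Nat.one_le_iff_ne_zero.mp hq)
  set k : ℕ := n / q
  set r : ℕ := n % q
  have hn : (n : ℝ) = q * (k : ℝ) + (r : ℝ) := by exact_mod_cast (Nat.div_add_mod n q).symm
  have hint : ((q : ℝ) * (k : ℝ) ^ 2 + 2 * k * r) * (a : ℝ) = (((q * k ^ 2 + 2 * k * r) * a : ℤ) : ℝ) := by
    push_cast; ring
  have : ((a : ℝ) / q + θ) * (n : ℝ) ^ 2 + β * n =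
      (((r : ℝ) ^ 2) * ((a : ℝ) / q) + ((n : ℝ) * β + θ * (n : ℝ) ^ 2)) +
        ((q : ℝ) * (k : ℝ) ^ 2 + 2 * k * r) * (a : ℝ) := by
    rw [hn]; field_simp; ring
  rw [this, hint, fourierChar_add_intCast, AddChar.map_add_eq_mul, Circle.coe_mul,
    AddChar.map_add_eq_mul, Circle.coe_mul]

/-- `‖e(θ(m+1)²) − e(θm²)‖ ≤ 2π|θ|(2m+1)`. [folklore] -/
private theorem norm_fourierChar_quad_succ_sub_le (m : ℕ) (θ : ℝ) :
    ‖(𝐞 (θ * ((m + 1 : ℕ) : ℝ) ^ 2) : ℂ) - (𝐞 (θ * (m : ℝ) ^ 2) : ℂ)‖ ≤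
      2 * π * |θ| * (2 * m + 1) := by
  have h1 : θ * ((m + 1 : ℕ) : ℝ) ^ 2 = θ * (m : ℝ) ^ 2 + θ * (2 * m + 1) := by push_cast; ring
  rw [h1, AddChar.map_add_eq_mul, Circle.coe_mul, ← mul_sub_one, norm_mul, norm_fourierChar,
    one_mul, norm_fourierChar_sub_one]
  have : |Real.sin (π * (θ * (2 * m + 1)))| ≤ |π * (θ * (2 * m + 1))| := Real.abs_sin_le_abs
  have hm : (0 : ℝ) ≤ 2 * m + 1 := by positivity
  rw [abs_mul, abs_of_pos Real.pi_pos, abs_mul, abs_of_nonneg hm] at this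
  linarith

/-- The trivial bound `‖∑_{n ≤ m, n ≡ r (q)} μ(n) e(nβ)‖ ≤ m`. [folklore] -/
private theorem norm_sum_filter_moebius_le (m q r : ℕ) (β : ℝ) :
    ‖∑ n ∈ (Icc 1 m).filter (fun n : ℕ => n % q = r), ((μ n : ℝ) : ℂ) * (𝐞 ((n : ℝ) * β) : ℂ)‖
      ≤ m := by
  refine (norm_sum_le _ _).trans ?_
  calc ∑ n ∈ (Icc 1 m).filter (fun n : ℕ => n % q = r), ‖((μ n : ℝ) : ℂ) * (𝐞 ((n : ℝ) * β) : ℂ)‖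
      ≤ ∑ n ∈ (Icc 1 m).filter (fun n : ℕ => n % q = r), (1 : ℝ) := by
        refine Finset.sum_le_sum fun n _ => ?_
        rw [norm_mul, norm_fourierChar, mul_one, Complex.norm_real, Real.norm_eq_abs]
        exact_mod_cast abs_moebius_le_one
    _ ≤ ∑ n ∈ Icc 1 m, (1 : ℝ) :=
        Finset.sum_le_sum_of_subset_of_nonneg (Finset.filter_subset _ _) fun _ _ _ => zero_le_one
    _ = m := by simp

/-- The trivial bound `‖∑_{n ≤ N} μ(n) e(αn² + βn)‖ ≤ N`. [folklore] -/
private theorem norm_quadSum_le (N : ℕ) (α β : ℝ) :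
    ‖∑ n ∈ Icc 1 N, ((μ n : ℝ) : ℂ) * (𝐞 (α * (n : ℝ) ^ 2 + β * n) : ℂ)‖ ≤ N := by
  refine (norm_sum_le _ _).trans ?_
  calc ∑ n ∈ Icc 1 N, ‖((μ n : ℝ) : ℂ) * (𝐞 (α * (n : ℝ) ^ 2 + β * n) : ℂ)‖
      ≤ ∑ n ∈ Icc 1 N, (1 : ℝ) := by
        refine Finset.sum_le_sum fun n _ => ?_
        rw [norm_mul, norm_fourierChar, mul_one, Complex.norm_real, Real.norm_eq_abs]
        exact_mod_cast abs_moebius_le_one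
    _ = N := by simp

/-! ### The major arcs -/

/-- **Green–Tao 2008, Proposition 18 (major arc quadratic phases are orthogonal to Möbius)**, in
the log-power form used for Hua's estimate (`Q = K = (log N)^B`), for the initial sum: for all
`A, B > 0` there is `C` (ineffective) such that for `N ≥ 2`, `1 ≤ q ≤ (log N)^B`, `a ∈ ℤ` and
`|α − a/q| ≤ (log N)^B/(qN²)`,
`‖∑_{n ≤ N} μ(n) e(αn² + βn)‖ ≤ C N/(log N)^A`, uniformly in `β`.
(Printed: "Let `N` be a large integer, `α, β, γ ∈ ℝ/ℤ`, and let `Q, K ≥ 1` be such that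
`‖α‖_{ℝ/ℤ,Q} ≤ K/N²`. Then `𝔼_{N<n≤2N} μ(n)e(−αn² − βn − γ) ≪_{A'} Q^{1/3}K^{1/3} log^{−A'} N` for
any `A' > 0`; the implied constant is ineffective." Our proof replaces the short-interval
linearisation by Abel summation against `e(θn²)`, `θ = α − a/q`, and the Gauss-sum Fourier
expansion of `e(an²/q)` by the residue classes of `n` mod `q`; the linear input is Davenport's
bound on progressions `MoebiusDavenport.davenport_progression`.)
[cite: GreenTao2008QuadraticMobius, §7 Proposition 18 (major arc quadratic phases; variant Q = K = log^B N, initial sums)] -/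
theorem majorArc (A B : ℝ) (hA : 0 < A) (hB : 0 < B) :
    ∃ C : ℝ, ∀ N : ℕ, 2 ≤ N → ∀ (q : ℕ) (a : ℤ) (α β : ℝ), 1 ≤ q → (q : ℝ) ≤ Real.log N ^ B →
      |α - a / q| ≤ Real.log N ^ B / (q * (N : ℝ) ^ 2) →
        ‖∑ n ∈ Icc 1 N, ((μ n : ℝ) : ℂ) * (𝐞 (α * (n : ℝ) ^ 2 + β * n) : ℂ)‖ ≤
          C * N / Real.log N ^ A := by
  set s : ℝ := A + B with hs
  have hs0 : 0 < s := by positivity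
  -- Davenport on progressions, saving `(log)^{-s}`
  obtain ⟨C₁', hC₁'⟩ := davenport_progression s hs0
  set C₁ : ℝ := max C₁' 0 with hC₁def
  have hC₁ : 0 ≤ C₁ := le_max_right _ _
  have hV : ∀ m : ℕ, 2 ≤ m → ∀ q : ℕ, 1 ≤ q → ∀ r : ℕ, ∀ β : ℝ,
      ‖∑ n ∈ (Icc 1 m).filter (fun n : ℕ => n % q = r), ((μ n : ℝ) : ℂ) * (𝐞 ((n : ℝ) * β) : ℂ)‖
        ≤ C₁ * m / Real.log m ^ s := by
    intro m hm q hq r β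
    refine (hC₁' m hm q hq r β).trans ?_
    have hm1 : (1 : ℝ) < m := by exact_mod_cast (lt_of_lt_of_le (by norm_num) hm)
    have : 0 ≤ (m : ℝ) / Real.log m ^ s := by
      have := Real.log_pos hm1; positivity
    calc C₁' * m / Real.log m ^ s = C₁' * (m / Real.log m ^ s) := by ring
      _ ≤ C₁ * (m / Real.log m ^ s) := mul_le_mul_of_nonneg_right (le_max_left _ _) this
      _ = C₁ * m / Real.log m ^ s := by ring
  -- thresholds in `N`
  have hev : ∀ᶠ N : ℕ in atTop, 4 ≤ Real.log N ∧
      14 * Real.log N ^ (A + B) ≤ (N : ℝ) ^ (1 / 2 : ℝ) := by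
    refine (eventually_le_log 4).and ?_
    filter_upwards [eventually_le_log 14,
      eventually_log_rpow_le_rpow (A + B + 1) (by norm_num : (0 : ℝ) < 1 / 2)] with N h14 h
    refine le_trans ?_ h
    have hL0 : 0 < Real.log N := by linarith
    rw [Real.rpow_add_one hL0.ne', mul_comm]
    exact mul_le_mul_of_nonneg_left h14 (Real.rpow_nonneg hL0.le _)
  obtain ⟨N₀, hN₀⟩ := eventually_atTop.mp hev
  -- the constant
  set C₂ : ℝ := (1 + 4 * π) * C₁ * 2 ^ s + 1 with hC₂
  have hC₂0 : 0 ≤ C₂ := by positivity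
  refine ⟨max C₂ (Real.log N₀ ^ A), fun N hN q a α β hq hqL hα => ?_⟩
  have hN0 : (0 : ℝ) < N := by exact_mod_cast (lt_of_lt_of_le (by norm_num) hN)
  have hN1 : (1 : ℝ) < N := by exact_mod_cast (lt_of_lt_of_le (by norm_num) hN)
  have hq0 : (0 : ℝ) < q := by exact_mod_cast hq
  have hqpos : 0 < q := hq
  set L : ℝ := Real.log N with hL
  have hLpos : 0 < L := Real.log_pos hN1
  have hLA : 0 < L ^ A := Real.rpow_pos_of_pos hLpos A
  have hLB : 0 < L ^ B := Real.rpow_pos_of_pos hLpos B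
  have htriv := norm_quadSum_le N α β
  by_cases hsmall : N < N₀
  · -- trivial regime `N < N₀`
    have h1 : L ^ A ≤ Real.log N₀ ^ A := by
      refine Real.rpow_le_rpow hLpos.le ?_ hA.le
      exact Real.log_le_log hN0 (by exact_mod_cast hsmall.le)
    rw [le_div_iff₀ hLA]
    calc ‖∑ n ∈ Icc 1 N, ((μ n : ℝ) : ℂ) * (𝐞 (α * (n : ℝ) ^ 2 + β * n) : ℂ)‖ * L ^ A
        ≤ N * Real.log N₀ ^ A := mul_le_mul htriv h1 hLA.le hN0.le
      _ ≤ max C₂ (Real.log N₀ ^ A) * N := by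
          rw [mul_comm]; exact mul_le_mul_of_nonneg_right (le_max_right _ _) hN0.le
  -- main regime: it suffices to prove the bound with `C₂`
  suffices hmain : ‖∑ n ∈ Icc 1 N, ((μ n : ℝ) : ℂ) * (𝐞 (α * (n : ℝ) ^ 2 + β * n) : ℂ)‖ ≤
      C₂ * N / L ^ A by
    refine hmain.trans ?_
    rw [mul_div_assoc, mul_div_assoc]
    exact mul_le_mul_of_nonneg_right (le_max_left _ _) (by positivity)
  obtain ⟨hL4, hL14⟩ := hN₀ N (not_lt.mp hsmall)
  have hsqN : 0 < Real.sqrt N := Real.sqrt_pos.2 hN0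
  have hsqrtN : Real.sqrt N = (N : ℝ) ^ (1 / 2 : ℝ) := Real.sqrt_eq_rpow N
  have hLs : L ^ s = L ^ A * L ^ B := by rw [hs, Real.rpow_add hLpos]
  -- `θ = α - a/q`
  set θ : ℝ := α - a / q with hθdef
  have hαθ : α = (a : ℝ) / q + θ := by rw [hθdef]; ring
  have hθ : |θ| ≤ L ^ B / (q * (N : ℝ) ^ 2) := hα
  -- the uniform bound for `V_r(m) = ∑_{n ≤ m, n ≡ r (q)} μ(n) e(nβ)`
  set E : ℝ := C₁ * 2 ^ s * N / L ^ s with hE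
  have hE0 : 0 ≤ E := by positivity
  have hVm : ∀ r : ℕ, ∀ m : ℕ, m ≤ N →
      ‖∑ n ∈ (Icc 1 m).filter (fun n : ℕ => n % q = r), ((μ n : ℝ) : ℂ) * (𝐞 ((n : ℝ) * β) : ℂ)‖
        ≤ Real.sqrt N + E := by
    intro r m hmN
    by_cases hm : (m : ℝ) < Real.sqrt N
    · have := norm_sum_filter_moebius_le m q r β
      linarith
    · have hm' : Real.sqrt N ≤ m := not_lt.mp hm
      have h2sq : (2 : ℝ) ≤ Real.sqrt N := by
        rw [show (2 : ℝ) = Real.sqrt 4 by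
          rw [show (4 : ℝ) = 2 ^ 2 by norm_num, Real.sqrt_sq (by norm_num)]]
        refine Real.sqrt_le_sqrt ?_
        have : Real.exp 4 ≤ N := by
          have := Real.exp_le_exp.mpr hL4
          rwa [Real.exp_log hN0] at this
        have h16 : (4 : ℝ) ≤ Real.exp 4 := by
          have := Real.add_one_le_exp (4 : ℝ); linarith
        linarith
      have hm2 : 2 ≤ m := by exact_mod_cast (h2sq.trans hm')
      have hm0 : (0 : ℝ) < m := by exact_mod_cast (lt_of_lt_of_le (by norm_num) hm2)
      have hlogm : L / 2 ≤ Real.log m := by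
        have : Real.log (Real.sqrt N) = L / 2 := by rw [Real.log_sqrt hN0.le, hL]
        rw [← this]
        exact Real.log_le_log hsqN hm'
      have hlogm0 : 0 < Real.log m := by linarith
      refine (hV m hm2 q hq r β).trans ?_
      have h1 : (L / 2) ^ s ≤ Real.log m ^ s := Real.rpow_le_rpow (by linarith) hlogm hs0.le
      have h2 : 0 < (L / 2) ^ s := Real.rpow_pos_of_pos (by linarith) s
      have hmN' : (m : ℝ) ≤ N := by exact_mod_cast hmN
      calc C₁ * m / Real.log m ^ s ≤ C₁ * N / (L / 2) ^ s := by
            rw [div_le_div_iff₀ (Real.rpow_pos_of_pos hlogm0 s) h2]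
            have := mul_le_mul hmN' h1 h2.le hN0.le
            nlinarith
        _ = E := by
            rw [hE, Real.div_rpow hLpos.le (by norm_num), div_div_eq_mul_div]
            ring
        _ ≤ Real.sqrt N + E := by linarith [hsqN.le]
  -- residue decomposition
  set U : ℕ → ℂ := fun r => ∑ n ∈ (Icc 1 N).filter (fun n : ℕ => n % q = r),
    ((μ n : ℝ) : ℂ) * ((𝐞 ((n : ℝ) * β) : ℂ) * (𝐞 (θ * (n : ℝ) ^ 2) : ℂ)) with hU
  have hS : ∑ n ∈ Icc 1 N, ((μ n : ℝ) : ℂ) * (𝐞 (α * (n : ℝ) ^ 2 + β * n) : ℂ) =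
      ∑ r ∈ range q, (𝐞 ((((r : ℕ) : ℝ) ^ 2) * ((a : ℝ) / q)) : ℂ) * U r := by
    rw [← Finset.sum_fiberwise_of_maps_to (s := Icc 1 N) (t := range q) (g := fun n => n % q)
      (fun n _ => mem_range.mpr (Nat.mod_lt n hqpos))]
    refine Finset.sum_congr rfl fun r _ => ?_
    simp only [hU]
    rw [Finset.mul_sum]
    refine Finset.sum_congr rfl fun n hn => ?_
    rw [(Finset.mem_filter.mp hn).2.symm, hαθ, fourierChar_quad_rat_add n hq a θ β]
    ring
  -- Abel summation on each residue class
  have hUle : ∀ r ∈ range q, ‖U r‖ ≤ (Real.sqrt N + E) * (1 + 4 * π * L ^ B / q) := by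
    intro r _
    set c : ℕ → ℂ := fun n => if n % q = r then ((μ n : ℝ) : ℂ) * (𝐞 ((n : ℝ) * β) : ℂ) else 0
      with hc
    have hUr : U r = ∑ n ∈ Icc 1 N, c n * (𝐞 (θ * (n : ℝ) ^ 2) : ℂ) := by
      simp only [hU]
      rw [Finset.sum_filter]
      refine Finset.sum_congr rfl fun n _ => ?_
      simp only [hc]
      split_ifs <;> simp [mul_assoc]
    have hVc : ∀ m, ∑ n ∈ Icc 1 m, c n =
        ∑ n ∈ (Icc 1 m).filter (fun n : ℕ => n % q = r),
          ((μ n : ℝ) : ℂ) * (𝐞 ((n : ℝ) * β) : ℂ) := by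
      intro m; rw [hc, Finset.sum_filter]
    -- Lipschitz constant of `e(θ n²)` on `[1, N]`
    have hδ : ∀ m : ℕ, 1 ≤ m → m < N →
        ‖(𝐞 (θ * ((m + 1 : ℕ) : ℝ) ^ 2) : ℂ) - (𝐞 (θ * (m : ℝ) ^ 2) : ℂ)‖ ≤
          4 * π * L ^ B / (q * N) := by
      intro m _ hmN
      refine (norm_fourierChar_quad_succ_sub_le m θ).trans ?_
      have h2m : (2 * m + 1 : ℝ) ≤ 2 * N := by
        have : 2 * m + 1 ≤ 2 * N := by omega
        exact_mod_cast this
      calc 2 * π * |θ| * (2 * m + 1) ≤ 2 * π * (L ^ B / (q * (N : ℝ) ^ 2)) * (2 * N) := by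
            gcongr
        _ = 4 * π * L ^ B / (q * N) := by field_simp; ring
    rw [hUr]
    have habel := norm_sum_mul_le_of_lipschitz c (fun n => (𝐞 (θ * (n : ℝ) ^ 2) : ℂ)) N
      (fun n => (norm_fourierChar _).le) hδ
    refine habel.trans ?_
    simp_rw [hVc]
    have h1 := hVm r N le_rfl
    have h2 : ∑ m ∈ Ico 1 N, ‖∑ n ∈ (Icc 1 m).filter (fun n : ℕ => n % q = r),
        ((μ n : ℝ) : ℂ) * (𝐞 ((n : ℝ) * β) : ℂ)‖ ≤ N * (Real.sqrt N + E) := by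
      calc ∑ m ∈ Ico 1 N, ‖∑ n ∈ (Icc 1 m).filter (fun n : ℕ => n % q = r),
            ((μ n : ℝ) : ℂ) * (𝐞 ((n : ℝ) * β) : ℂ)‖
          ≤ ∑ m ∈ Ico 1 N, (Real.sqrt N + E) :=
            Finset.sum_le_sum fun m hm => hVm r m (Finset.mem_Ico.mp hm).2.le
        _ = ((N - 1 : ℕ) : ℝ) * (Real.sqrt N + E) := by
            rw [Finset.sum_const, Nat.card_Ico, nsmul_eq_mul]
        _ ≤ N * (Real.sqrt N + E) := by
            refine mul_le_mul_of_nonneg_right ?_ (by positivity)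
            exact_mod_cast Nat.sub_le N 1
    calc ‖∑ n ∈ (Icc 1 N).filter (fun n : ℕ => n % q = r),
            ((μ n : ℝ) : ℂ) * (𝐞 ((n : ℝ) * β) : ℂ)‖ +
          4 * π * L ^ B / (q * N) * ∑ m ∈ Ico 1 N,
            ‖∑ n ∈ (Icc 1 m).filter (fun n : ℕ => n % q = r),
              ((μ n : ℝ) : ℂ) * (𝐞 ((n : ℝ) * β) : ℂ)‖
        ≤ (Real.sqrt N + E) + 4 * π * L ^ B / (q * N) * (N * (Real.sqrt N + E)) :=
          add_le_add h1 (mul_le_mul_of_nonneg_left h2 (by positivity))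
      _ = (Real.sqrt N + E) * (1 + 4 * π * L ^ B / q) := by
          field_simp
  -- sum over the residues
  have hpi : 1 + 4 * π ≤ 14 := by have := Real.pi_lt_d2; linarith
  have hmain1 : (1 + 4 * π) * L ^ B * Real.sqrt N ≤ N / L ^ A := by
    rw [le_div_iff₀ hLA]
    rw [← hsqrtN] at hL14
    calc (1 + 4 * π) * L ^ B * Real.sqrt N * L ^ A
        = (1 + 4 * π) * (L ^ A * L ^ B) * Real.sqrt N := by ring
      _ ≤ 14 * (L ^ A * L ^ B) * Real.sqrt N := by gcongr
      _ = 14 * L ^ (A + B) * Real.sqrt N := by rw [Real.rpow_add hLpos]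
      _ ≤ Real.sqrt N * Real.sqrt N := mul_le_mul_of_nonneg_right hL14 hsqN.le
      _ = N := Real.mul_self_sqrt hN0.le
  have hmain2 : (1 + 4 * π) * L ^ B * E = (1 + 4 * π) * C₁ * 2 ^ s * N / L ^ A := by
    rw [hE, hLs]
    field_simp
  calc ‖∑ n ∈ Icc 1 N, ((μ n : ℝ) : ℂ) * (𝐞 (α * (n : ℝ) ^ 2 + β * n) : ℂ)‖
      = ‖∑ r ∈ range q, (𝐞 ((((r : ℕ) : ℝ) ^ 2) * ((a : ℝ) / q)) : ℂ) * U r‖ := by rw [hS]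
    _ ≤ ∑ r ∈ range q, ‖(𝐞 ((((r : ℕ) : ℝ) ^ 2) * ((a : ℝ) / q)) : ℂ) * U r‖ := norm_sum_le _ _
    _ ≤ ∑ r ∈ range q, (Real.sqrt N + E) * (1 + 4 * π * L ^ B / q) := by
        refine Finset.sum_le_sum fun r hr => ?_
        rw [norm_mul, norm_fourierChar, one_mul]
        exact hUle r hr
    _ = q * ((Real.sqrt N + E) * (1 + 4 * π * L ^ B / q)) := by
        rw [Finset.sum_const, Finset.card_range, nsmul_eq_mul]
    _ = (Real.sqrt N + E) * (q + 4 * π * L ^ B) := by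
        field_simp
    _ ≤ (Real.sqrt N + E) * (L ^ B + 4 * π * L ^ B) :=
        mul_le_mul_of_nonneg_left (by linarith) (by positivity)
    _ = (1 + 4 * π) * L ^ B * Real.sqrt N + (1 + 4 * π) * L ^ B * E := by ring
    _ ≤ N / L ^ A + (1 + 4 * π) * C₁ * 2 ^ s * N / L ^ A := by
        rw [hmain2] at *; exact add_le_add hmain1 le_rfl
    _ = C₂ * N / L ^ A := by rw [hC₂]; ring

end Literature.NumberTheory.Sieve.HuaQuadratic
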